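import Literature.MathematicalPhysics.QuantumLattice.TIGroundEnergyDensityCouplingFamilies
import Literature.MathematicalPhysics.QuantumLattice.HubbardEnergyDensityChemicalPotential
import HarnessLib

/-!
# Conserved densities as constraints: the translation-invariant ground-state energy density at
# prescribed values of finitely many conserved densities is JOINTLY CONVEX in those values, and the
# Legendre link with the field / chemical-potential directions; the spin-imbalance (Zeeman)
# direction of lattice fermions typed

Topic `Literature/MathematicalPhysics/QuantumLattice` (model-free, general `d`); namespace
`Literature.MathematicalPhysics.QuantumLattice` (the file path). Companion of
`TIGroundEnergyDensityCouplingFamilies.lean` (linear coupling families `Ψ₀ + Σθ_aΨ_a`, the variational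
density `infMeanEnergyOn S Ψ R` over a state class, the density-constrained `tiGroundEnergyDensityAt`)
and `TIGroundEnergyDensityResponse.lean` (`numberInteraction`, the `μ`-pencil). Written for the Hubbard
material-oracle stage S2 (D-0096 (ii)/(iii), D-0098: the phase map is drawn over `T × P × H`; at the
model level the FIELD axis `H` and the FILLING axis are conserved-charge directions — Zeeman coupling
`−h(N↑ − N↓)` and `−μN` — whose grand-canonical ↔ canonical dictionary is the same convex duality for
every model).

* §1 ON-SITE INTERACTIONS: for an interaction supported on singletons the mean-energy observable is
  its term at the origin (`FermionInteraction.meanEnergyObs_of_onSite`, `meanEnergy_of_onSite`). The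
  SPIN-IMBALANCE interaction `spinImbalanceInteraction d` (`Φ {x} = n_{x↑} − n_{x↓}`, the Zeeman /
  `S^z` direction up to the factor `½`): even, Hermitian, range `0`; its conjugate density is the spin
  imbalance `Re ω(n_{0↑} − n_{0↓})` (`meanEnergy_spinImbalanceInteraction`), kinematically bracketed by
  `±min(ρ, 2 − ρ)` at density `ρ` (`meanEnergy_spinImbalance_mem_Icc`) — the class-wide bracket the
  transport theorems of the companion file consume.
* §2 CONSTRAINT CLASSES `InfVolFermionState.tiClassWith C R c = {ω TI : e_{C_k}(ω) = c_k ∀ k}` for a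
  family of "charge" interactions `C_k` (number, spin imbalance, sublattice numbers, …): closed under
  mixtures with affine constraint values (`mix_mem_tiClassWith`); the filling class of the companion
  file is the case `C = n` (`setOf_density_eq_tiClassWith`).
* §3 JOINT CONVEXITY IN THE CONSTRAINT VALUES: `c ↦ inf {e_Ψ(ω) : ω ∈ tiClassWith C R c}` is convex
  on every convex set of realised constraint vectors (`infMeanEnergyOn_tiClassWith_convex_comb_le`,
  `convexOn_infMeanEnergyOn_tiClassWith`; Ruelle 1969 §3.4 — convexity of the energy density in the
  particle density; here jointly in `(ρ, m, …)`).
* §4 THE MULTI-PARAMETER LEGENDRE LINK with the linear family `Ψ + Σ_k λ_k C_k` (e.g.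
  `λ = (−μ, −h)`): sheets `e₀(Ψ + ΣλC) − Σ λ_k c_k ≤ e_c(Ψ)` at every realised `c`
  (`tiGroundEnergyDensity_linearFamily_sub_sum_le`), the floor form, and
  `e₀(Ψ + ΣλC) = inf_c (e_c(Ψ) + Σ λ_k c_k)` (`isGLB_tiGroundEnergyDensity_linearFamily_charges`);
  EQUIVALENCE OF ENSEMBLES (easy direction): a translation-invariant minimiser of `Ψ + ΣλC` is a
  constrained minimiser of `Ψ` at its own charge values (`isMinOn_tiClassWith_of_isMeanEnergyMinimiser`)
  — what a grand-canonical solver at `(μ, h)` delivers is a canonical ground state at its `(ρ, m)`.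
* §5 The `t–t'` Hubbard model with chemical potential AND Zeeman field as an instance:
  `e₀(Φ(t,t',U) + θ₀·n + θ₁·s)` is jointly concave in `(θ₀, θ₁) = (−μ, −2h)`… (any sign convention:
  the statement is in the coefficients), and equals `inf_{(ρ, m)} (e_{ρ,m}(Φ) + θ₀ρ + θ₁m)` over the
  realised (density, spin-imbalance) pairs (`concaveOn_tiGroundEnergyDensity_hubbardTTPrime_charges`,
  `isGLB_tiGroundEnergyDensity_hubbardTTPrime_charges`).

Everything is PROVED; the two definitions (`spinImbalanceInteraction`, `tiClassWith`) have bodies; no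
named fact, no number, no `sorry`. HONEST SCOPE: convexity / duality lemmas only; no claim about
magnetic order, no thermodynamic-limit identification of the `(ρ, m)`-constrained density with sector
ground-state energies of tori (the tree has it for the filling constraint of the `t–t'` model only,
`tiGroundEnergyDensityAt_hubbardTTPrime_eq_energyDensityTT'`).

## Mathlib / tree search

Tree (REUSED): `numberInteraction`, `meanEnergy_numberInteraction`, `FermionInteraction.meanEnergyObs_eq_sum`
(`HubbardFermionInteractionTerms`), `re_expect_nAt_nonneg / _le_one` (`HubbardEnergyDensityChemicalPotential`),
`density_mix`, `meanEnergy_mix`, `IsTranslationInvariant.mix`, and the companion file's `linearFamily`,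
`infMeanEnergyOn`, `meanEnergy_linearFamily`, `exists_meanEnergy_lt_of_infMeanEnergyOn_lt`.
`lean search 'magneti[sz]ation|zeeman|spinImbalance'` on `InfVolFermionState`: nothing (the tree's
magnetisations are Heisenberg-model / torus objects).

## References

* D. Ruelle, *Statistical Mechanics: Rigorous Results* (1969), §3.4. [cite: Ruelle1969, §3.4]
* R. B. Israel, *Convexity in the Theory of Lattice Gases* (1979), Thm. I.3.4. [cite: Israel1979, Thm. I.3.4]
* R. B. Griffiths, Phys. Rev. 152 (1966) 240, §II. [cite: Griffiths1966, §II]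
* O. Bratteli, A. Kishimoto, D. W. Robinson, Commun. Math. Phys. 64 (1978) 41, Thm. 2.
  [cite: BratteliKishimotoRobinson1978, Thm. 2]
* H. Araki, H. Moriya, Rev. Math. Phys. 15 (2003) 93, §4.1, §5.1. [cite: ArakiMoriya2003, §5.1]
-/

noncomputable section

namespace Literature.MathematicalPhysics.QuantumLattice

open Matrix Finset HubbardWave0 Literature.Probability.LatticeModels ThermodynamicLimit
open scoped ComplexOrder BigOperators

variable {d : ℕ}

/-! ### §1. On-site interactions; the spin-imbalance (Zeeman) direction -/

namespace FermionInteraction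

/-- **The mean-energy observable of an on-site interaction is its term at the origin** (embedded in
`𝔄_{thicken {0} R}`): if `Φ X = 0` unless `X` is a singleton, the only `X ∋ 0` carrying a term is
`{0}`. [cite: BratteliKishimotoRobinson1978, §3 (mean energy functional)] -/
theorem meanEnergyObs_of_onSite (Ψ : FermionInteraction d)
    (hΨ : ∀ X : Finset (Site d), (∀ x : Site d, X ≠ {x}) → Ψ.Φ X = 0) (R : ℝ) :
    Ψ.meanEnergyObs R =
      fermionEmbed (PolySite.incl (singleton_subset_iff.2 (zero_mem_thicken_zero R))) (Ψ.Φ {0}) := by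
  classical
  set T : Finset (Site d) := thicken ({0} : Finset (Site d)) R with hT
  set F : Finset (Site d) → FermionOp T := fun X =>
    if h : X ⊆ T then ((X.card : ℂ)⁻¹) • fermionEmbed (PolySite.incl h) (Ψ.Φ X) else 0 with hF
  rw [FermionInteraction.meanEnergyObs_eq_sum]
  change ∑ X ∈ T.powerset with (0 : Site d) ∈ X, F X = _
  have h0T : ({0} : Finset (Site d)) ⊆ T := singleton_subset_iff.2 (zero_mem_thicken_zero R)
  have hmem : ({0} : Finset (Site d)) ∈ T.powerset.filter (fun X => (0 : Site d) ∈ X) :=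
    mem_filter.2 ⟨mem_powerset.2 h0T, mem_singleton_self (0 : Site d)⟩
  rw [Finset.sum_eq_single ({0} : Finset (Site d))]
  · simp only [hF]
    rw [dif_pos h0T, card_singleton, Nat.cast_one, inv_one, one_smul]
  · intro X hX hne
    have hΦ : Ψ.Φ X = 0 := by
      refine hΨ X fun x hx => hne ?_
      have h0 := (mem_filter.1 hX).2
      rw [hx, mem_singleton] at h0
      rw [hx, h0]
    simp only [hF, hΦ, map_zero, smul_zero, dite_eq_ite, ite_self]
  · exact fun h => absurd hmem h

end FermionInteraction

namespace InfVolFermionState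

/-- **The mean energy of an on-site interaction is the expectation of its term at the origin**:
`e_Ψ(ω) = Re ω(Φ {0})`. [cite: BratteliKishimotoRobinson1978, §3 (mean energy functional)] -/
theorem meanEnergy_of_onSite (ω : InfVolFermionState d) (Ψ : FermionInteraction d)
    (hΨ : ∀ X : Finset (Site d), (∀ x : Site d, X ≠ {x}) → Ψ.Φ X = 0) (R : ℝ) :
    ω.meanEnergy Ψ R = (ω.expect {0} (Ψ.Φ {0})).re := by
  rw [InfVolFermionState.meanEnergy, Ψ.meanEnergyObs_of_onSite hΨ, ω.compatible]

end InfVolFermionState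

/-- **The spin-imbalance interaction** `s`: `Φ {x} = n_{x↑} − n_{x↓}`, `Φ X = 0` for `|X| ≠ 1` — the
conserved `S^z`-density direction of lattice fermions (`2S^z_x`); the Zeeman term of a field `h` is the
pencil / linear-family direction with coefficient `−h` (up to the normalisation of `S^z`). Araki–Moriya
(2003) §5.1 (one-body potentials); Griffiths (1966) §II (field conjugate to the magnetisation).
[cite: ArakiMoriya2003, §5.1] -/
def spinImbalanceInteraction (d : ℕ) : FermionInteraction d where
  Φ X := ∑ x ∈ X.attach, if X = {x.1} then (nAt x.1 x.2 0 - nAt x.1 x.2 1) else 0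

/-- **On-site term**: `Φ_s {x} = n_{x↑} − n_{x↓}`. [cite: ArakiMoriya2003, §5.1] -/
theorem spinImbalanceInteraction_apply_singleton (x : Site d) :
    (spinImbalanceInteraction d).Φ {x} = nAt x (mem_singleton_self x) 0 - nAt x (mem_singleton_self x) 1 := by
  simp only [spinImbalanceInteraction]
  rw [Finset.sum_eq_single ⟨x, mem_singleton_self x⟩, if_pos rfl]
  · rintro ⟨b, hb⟩ - hne
    exact absurd (Subtype.ext (mem_singleton.1 hb)) hne
  · intro h
    exact absurd (mem_attach _ _) h

/-- **All other terms vanish**: `Φ_s X = 0` unless `X` is a singleton. [cite: ArakiMoriya2003, §5.1] -/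
theorem spinImbalanceInteraction_apply_eq_zero {X : Finset (Site d)} (h1 : ∀ x : Site d, X ≠ {x}) :
    (spinImbalanceInteraction d).Φ X = 0 := by
  simp only [spinImbalanceInteraction, h1, if_false, sum_const_zero]

/-- The spin-imbalance interaction is even. [cite: ArakiMoriya2003, §1 assumption (II)] -/
theorem spinImbalanceInteraction_isEven : (spinImbalanceInteraction d).IsEven := by
  intro X
  have hn : ∀ (x : Site d) (hx : x ∈ X) (σ : Fin 2), parityAut (nAt x hx σ) = nAt x hx σ := by
    intro x hx σ
    rw [nAt, numberOp, map_mul, parityAut_creation, parityAut_annihilation, neg_mul_neg]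
  simp only [spinImbalanceInteraction, map_sum, apply_ite parityAut, map_zero, map_sub, hn]

/-- The spin-imbalance interaction is Hermitian. [cite: ArakiMoriya2003, §1 assumption (II)] -/
theorem spinImbalanceInteraction_isHermitian : (spinImbalanceInteraction d).IsHermitian := by
  intro X
  have hn : ∀ (x : Site d) (hx : x ∈ X) (σ : Fin 2), (nAt x hx σ)ᴴ = nAt x hx σ := by
    intro x hx σ
    rw [nAt, ← numberAt_orb, (numberAt_isHermitian _).eq]
  unfold Matrix.IsHermitian
  simp only [spinImbalanceInteraction, Matrix.conjTranspose_sum, apply_ite Matrix.conjTranspose,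
    Matrix.conjTranspose_zero, Matrix.conjTranspose_sub, hn]

/-- The spin-imbalance interaction has range `0` (hence every range `R ≥ 0`). [cite: ArakiMoriya2003, §5.4] -/
theorem spinImbalanceInteraction_hasFiniteRange (R : ℝ) (hR : 0 ≤ R) :
    (spinImbalanceInteraction d).HasFiniteRange R := by
  intro X hX
  refine spinImbalanceInteraction_apply_eq_zero fun x hx => ?_
  rw [hx, coe_singleton, Metric.diam_singleton] at hX
  exact absurd hX (not_lt.2 hR)

/-- The mean-energy observable of the spin-imbalance interaction is `n_{0↑} − n_{0↓}` (embedded).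
[cite: BratteliKishimotoRobinson1978, §3 (mean energy functional)] -/
theorem spinImbalanceInteraction_meanEnergyObs (R : ℝ) :
    (spinImbalanceInteraction d).meanEnergyObs R =
      fermionEmbed (PolySite.incl (singleton_subset_iff.2 (zero_mem_thicken_zero R)))
        ((spinImbalanceInteraction d).Φ {0}) :=
  (spinImbalanceInteraction d).meanEnergyObs_of_onSite (fun _ h => spinImbalanceInteraction_apply_eq_zero h) R

namespace InfVolFermionState

variable (ω : InfVolFermionState d)

/-- **The conjugate density of the spin-imbalance direction is the spin imbalance**
`e_s(ω) = Re ω(n_{0↑} − n_{0↓}) = ρ↑ − ρ↓` (twice the `S^z` density), for every state and every `R`.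
[cite: ArakiMoriya2003, §4.1] -/
theorem meanEnergy_spinImbalanceInteraction (R : ℝ) :
    ω.meanEnergy (spinImbalanceInteraction d) R =
      (ω.expect {0} (nAt 0 (mem_singleton_self 0) 0)).re -
        (ω.expect {0} (nAt 0 (mem_singleton_self 0) 1)).re := by
  rw [ω.meanEnergy_of_onSite _ (fun _ h => spinImbalanceInteraction_apply_eq_zero h),
    spinImbalanceInteraction_apply_singleton, map_sub, Complex.sub_re]

/-- **Kinematic bracket by the density**: `|ρ↑ − ρ↓| ≤ ρ`. [cite: ArakiMoriya2003, §4.1] -/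
theorem abs_meanEnergy_spinImbalance_le_density (R : ℝ) :
    |ω.meanEnergy (spinImbalanceInteraction d) R| ≤ ω.density := by
  rw [ω.meanEnergy_spinImbalanceInteraction R, density, densityAt, map_add, Complex.add_re]
  have h0 := ω.re_expect_nAt_nonneg {0} (mem_singleton_self 0) 0
  have h1 := ω.re_expect_nAt_nonneg {0} (mem_singleton_self 0) 1
  rw [abs_le]
  constructor <;> linarith

/-- **Kinematic bracket by the hole density**: `|ρ↑ − ρ↓| ≤ 2 − ρ`. [cite: ArakiMoriya2003, §4.1] -/
theorem abs_meanEnergy_spinImbalance_le_two_sub_density (R : ℝ) :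
    |ω.meanEnergy (spinImbalanceInteraction d) R| ≤ 2 - ω.density := by
  rw [ω.meanEnergy_spinImbalanceInteraction R, density, densityAt, map_add, Complex.add_re]
  have h0 := ω.re_expect_nAt_le_one {0} (mem_singleton_self 0) 0
  have h1 := ω.re_expect_nAt_le_one {0} (mem_singleton_self 0) 1
  rw [abs_le]
  constructor <;> linarith

/-- **Class-wide kinematic bracket of the spin imbalance at density `ρ`**:
`e_s(ω) ∈ [−min(ρ, 2−ρ), min(ρ, 2−ρ)]` for every state of density `ρ` — the `[lo, hi]` slot of the
companion file's transport theorems for the field direction. [cite: ArakiMoriya2003, §4.1] -/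
theorem meanEnergy_spinImbalance_mem_Icc {ρ : ℝ} (hρ : ω.density = ρ) (R : ℝ) :
    ω.meanEnergy (spinImbalanceInteraction d) R ∈ Set.Icc (-min ρ (2 - ρ)) (min ρ (2 - ρ)) := by
  have h := abs_le.1 (le_min (ω.abs_meanEnergy_spinImbalance_le_density R)
    (ω.abs_meanEnergy_spinImbalance_le_two_sub_density R))
  rw [hρ] at h
  exact h

end InfVolFermionState

/-! ### §2. Constraint classes of translation-invariant states -/

namespace InfVolFermionState

variable {κ : Type*}

/-- **The translation-invariant states with prescribed conserved densities**: for a family of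
"charge" interactions `C_k` and values `c_k`, `{ω translation invariant : e_{C_k}(ω) = c_k ∀ k}`
(filling: `C = numberInteraction`, `e_n(ω) = ρ(ω)`; spin imbalance: `C = spinImbalanceInteraction`;
sublattice / orbital fillings likewise). The variational ground-state energy density over this class,
`infMeanEnergyOn (tiClassWith C R c) Ψ R`, is the canonical (micro-constrained) density at charges `c`.
[cite: Ruelle1969, §3.4] -/
def tiClassWith (C : κ → FermionInteraction d) (R : ℝ) (c : κ → ℝ) : Set (InfVolFermionState d) :=
  {ω : InfVolFermionState d | ω.IsTranslationInvariant ∧ ∀ k, ω.meanEnergy (C k) R = c k}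

variable (C : κ → FermionInteraction d) (R : ℝ)

/-- Membership (definitional). [cite: Ruelle1969, §3.4] -/
theorem mem_tiClassWith_iff {c : κ → ℝ} {ω : InfVolFermionState d} :
    ω ∈ tiClassWith C R c ↔ ω.IsTranslationInvariant ∧ ∀ k, ω.meanEnergy (C k) R = c k := Iff.rfl

/-- Every translation-invariant state lies in the class of its own charge values. [cite: Ruelle1969, §3.4] -/
theorem mem_tiClassWith_self {ω : InfVolFermionState d} (hω : ω.IsTranslationInvariant) :
    ω ∈ tiClassWith C R (fun k => ω.meanEnergy (C k) R) := ⟨hω, fun _ => rfl⟩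

/-- **Mixtures interpolate the charges**: `ω₁` with charges `c₁`, `ω₂` with charges `c₂`, weight
`a ∈ [0,1]` ⇒ `a ω₁ + (1−a) ω₂` is translation invariant with charges `a c₁ + (1−a) c₂` (the state
space is convex and mean energies are affine). [cite: BratteliRobinsonI1987, §4.3.1] -/
theorem mix_mem_tiClassWith {c₁ c₂ : κ → ℝ} {ω₁ ω₂ : InfVolFermionState d} (h₁ : ω₁ ∈ tiClassWith C R c₁)
    (h₂ : ω₂ ∈ tiClassWith C R c₂) (a : ℝ) (ha₀ : 0 ≤ a) (ha₁ : a ≤ 1) :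
    mix a ha₀ ha₁ ω₁ ω₂ ∈ tiClassWith C R (fun k => a * c₁ k + (1 - a) * c₂ k) :=
  ⟨h₁.1.mix h₂.1 a ha₀ ha₁, fun k => by rw [meanEnergy_mix, h₁.2 k, h₂.2 k]⟩

/-- **The filling class is a constraint class**: `{ω TI : ρ(ω) = ρ} = tiClassWith n R ρ` with the
particle-number interaction as the single charge (any `R`). [cite: ArakiMoriya2003, §4.1] -/
theorem setOf_density_eq_tiClassWith (R ρ : ℝ) :
    {ω : InfVolFermionState d | ω.IsTranslationInvariant ∧ ω.density = ρ} =
      tiClassWith (fun _ : Unit => numberInteraction d) R (fun _ => ρ) := by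
  ext ω
  simp only [Set.mem_setOf_eq, mem_tiClassWith_iff, meanEnergy_numberInteraction, forall_const]

/-- Hence the companion file's density-constrained density is the constrained density with the single
charge `n`. [cite: Ruelle1969, §3.4] -/
theorem tiGroundEnergyDensityAt_eq_infMeanEnergyOn_tiClassWith (Ψ : FermionInteraction d) (R ρ : ℝ) :
    Ψ.tiGroundEnergyDensityAt R ρ =
      FermionInteraction.infMeanEnergyOn (tiClassWith (fun _ : Unit => numberInteraction d) R (fun _ => ρ)) Ψ R := by
  rw [FermionInteraction.tiGroundEnergyDensityAt, setOf_density_eq_tiClassWith]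

end InfVolFermionState

/-! ### §3. Joint convexity in the constraint values -/

namespace FermionInteraction

variable {κ : Type*} (C : κ → FermionInteraction d) (Ψ : FermionInteraction d) (R : ℝ)

/-- **JOINT CONVEXITY IN THE CHARGES, three-point form.** For realised charge vectors `c₁, c₂` and
`a, b ≥ 0`, `a + b = 1`: `e_{a c₁ + b c₂}(Ψ) ≤ a e_{c₁}(Ψ) + b e_{c₂}(Ψ)`, where
`e_c(Ψ) = inf {e_Ψ(ω) : ω ∈ tiClassWith C R c}` (mix near-minimisers). Ruelle (1969) §3.4.
[cite: Ruelle1969, §3.4] -/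
theorem infMeanEnergyOn_tiClassWith_convex_comb_le {c₁ c₂ : κ → ℝ}
    (h₁ : (InfVolFermionState.tiClassWith C R c₁).Nonempty)
    (h₂ : (InfVolFermionState.tiClassWith C R c₂).Nonempty) {a b : ℝ} (ha : 0 ≤ a) (hb : 0 ≤ b)
    (hab : a + b = 1) :
    infMeanEnergyOn (InfVolFermionState.tiClassWith C R (fun k => a * c₁ k + b * c₂ k)) Ψ R ≤
      a * infMeanEnergyOn (InfVolFermionState.tiClassWith C R c₁) Ψ R +
        b * infMeanEnergyOn (InfVolFermionState.tiClassWith C R c₂) Ψ R := by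
  refine le_of_forall_pos_le_add fun ε hε => ?_
  obtain ⟨ω₁, hω₁, he₁⟩ := exists_meanEnergy_lt_of_infMeanEnergyOn_lt Ψ R h₁
    (lt_add_of_pos_right (infMeanEnergyOn (InfVolFermionState.tiClassWith C R c₁) Ψ R) hε)
  obtain ⟨ω₂, hω₂, he₂⟩ := exists_meanEnergy_lt_of_infMeanEnergyOn_lt Ψ R h₂
    (lt_add_of_pos_right (infMeanEnergyOn (InfVolFermionState.tiClassWith C R c₂) Ψ R) hε)
  have ha1 : a ≤ 1 := by linarith
  have hmix := InfVolFermionState.mix_mem_tiClassWith C R hω₁ hω₂ a ha ha1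
  have hb' : 1 - a = b := by linarith
  simp only [hb'] at hmix
  have hle := infMeanEnergyOn_le_meanEnergy Ψ R hmix
  rw [InfVolFermionState.meanEnergy_mix, hb'] at hle
  nlinarith [mul_le_mul_of_nonneg_left he₁.le ha, mul_le_mul_of_nonneg_left he₂.le hb]

/-- **JOINT CONVEXITY IN THE CHARGES.** On every convex set `D` of realised charge vectors,
`c ↦ e_c(Ψ)` is convex — jointly in (filling, spin imbalance, …). [cite: Ruelle1969, §3.4] -/
theorem convexOn_infMeanEnergyOn_tiClassWith {D : Set (κ → ℝ)} (hD : Convex ℝ D)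
    (hne : ∀ c ∈ D, (InfVolFermionState.tiClassWith C R c).Nonempty) :
    ConvexOn ℝ D fun c => infMeanEnergyOn (InfVolFermionState.tiClassWith C R c) Ψ R := by
  refine ⟨hD, fun x hx y hy a b ha hb hab => ?_⟩
  have h := infMeanEnergyOn_tiClassWith_convex_comb_le C Ψ R (hne x hx) (hne y hy) ha hb hab
  have hxy : a • x + b • y = fun k => a * x k + b * y k := by
    funext k; simp only [Pi.add_apply, Pi.smul_apply, smul_eq_mul]
  rw [hxy]
  simpa only [smul_eq_mul] using h

/-- **The unconstrained density is below every constrained one**: `e₀(Ψ) ≤ e_c(Ψ)` for realised `c`.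
[cite: BratteliKishimotoRobinson1978, Thm. 2 (condition 2)] -/
theorem tiGroundEnergyDensity_le_infMeanEnergyOn_tiClassWith {c : κ → ℝ}
    (hne : (InfVolFermionState.tiClassWith C R c).Nonempty) :
    Ψ.tiGroundEnergyDensity R ≤ infMeanEnergyOn (InfVolFermionState.tiClassWith C R c) Ψ R :=
  infMeanEnergyOn_anti Ψ R hne fun _ hω => hω.1

end FermionInteraction

/-! ### §4. The multi-parameter Legendre link and the easy half of the equivalence of ensembles -/

namespace FermionInteraction

variable {κ : Type*} [Fintype κ] (C : κ → FermionInteraction d) (Ψ : FermionInteraction d) (R : ℝ)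

/-- **SHEETS**: for the linear family `Ψ + Σ_k λ_k C_k` (e.g. `λ = (−μ, −h)`) and every realised
charge vector `c`: `e₀(Ψ + ΣλC) − Σ_k λ_k c_k ≤ e_c(Ψ)` — a certified lower bound on the
translation-invariant density of the field-coupled family is an affine floor under the constrained
density at EVERY charge vector. [cite: Ruelle1969, §3.4] -/
theorem tiGroundEnergyDensity_linearFamily_sub_sum_le (lam : κ → ℝ) {c : κ → ℝ}
    (hne : (InfVolFermionState.tiClassWith C R c).Nonempty) :
    (linearFamily Ψ C lam).tiGroundEnergyDensity R - ∑ k, lam k * c k ≤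
      infMeanEnergyOn (InfVolFermionState.tiClassWith C R c) Ψ R := by
  refine le_infMeanEnergyOn Ψ R hne fun ω hω => ?_
  have h := (linearFamily Ψ C lam).tiGroundEnergyDensity_le_meanEnergy R hω.1
  rw [ω.meanEnergy_linearFamily] at h
  have hs : ∑ k, lam k * ω.meanEnergy (C k) R = ∑ k, lam k * c k :=
    Finset.sum_congr rfl fun k _ => by rw [hω.2 k]
  linarith

/-- **FLOOR FORM**: if `x ≤ e_c(Ψ) + Σ_k λ_k c_k` for every realised `c`, then `x ≤ e₀(Ψ + ΣλC)`.
[cite: Ruelle1969, §3.4] -/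
theorem le_tiGroundEnergyDensity_linearFamily_of_forall_charges (lam : κ → ℝ) {x : ℝ}
    (h : ∀ c : κ → ℝ, (InfVolFermionState.tiClassWith C R c).Nonempty →
      x ≤ infMeanEnergyOn (InfVolFermionState.tiClassWith C R c) Ψ R + ∑ k, lam k * c k) :
    x ≤ (linearFamily Ψ C lam).tiGroundEnergyDensity R := by
  refine (linearFamily Ψ C lam).le_tiGroundEnergyDensity R fun ω hω => ?_
  rw [ω.meanEnergy_linearFamily]
  have h1 := h _ ⟨ω, InfVolFermionState.mem_tiClassWith_self C R hω⟩
  have h2 := infMeanEnergyOn_le_meanEnergy Ψ R (InfVolFermionState.mem_tiClassWith_self C R hω)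
  linarith

/-- **THE MULTI-PARAMETER LEGENDRE LINK**: `e₀(Ψ + Σ_k λ_k C_k)` is the greatest lower bound of
`{e_c(Ψ) + Σ_k λ_k c_k : c realised}` — the field-coupled translation-invariant density is the concave
conjugate of the jointly convex constrained density (`(μ, h) ↔ (ρ, m)` for every model).
[cite: Ruelle1969, §3.4] -/
theorem isGLB_tiGroundEnergyDensity_linearFamily_charges (lam : κ → ℝ) :
    IsGLB {y : ℝ | ∃ c : κ → ℝ, (InfVolFermionState.tiClassWith C R c).Nonempty ∧
        y = infMeanEnergyOn (InfVolFermionState.tiClassWith C R c) Ψ R + ∑ k, lam k * c k}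
      ((linearFamily Ψ C lam).tiGroundEnergyDensity R) := by
  refine ⟨?_, fun x hx => ?_⟩
  · rintro y ⟨c, hne, rfl⟩
    linarith [tiGroundEnergyDensity_linearFamily_sub_sum_le C Ψ R lam hne]
  · exact le_tiGroundEnergyDensity_linearFamily_of_forall_charges C Ψ R lam fun c hne =>
      hx ⟨c, hne, rfl⟩

end FermionInteraction

namespace InfVolFermionState

variable {κ : Type*} [Fintype κ] (C : κ → FermionInteraction d) (Ψ : FermionInteraction d) (R : ℝ)

/-- **Equivalence of ensembles, easy half**: a translation-invariant minimiser `ω` of the field-coupled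
family `Ψ + Σ_k λ_k C_k` (a "grand-canonical ground state at `(μ, h, …)`") minimises `e_Ψ` on the
constraint class of ITS OWN charge values — it is a canonical ground state at its `(ρ, m, …)`.
[cite: BratteliKishimotoRobinson1978, Thm. 2 (condition 2)] -/
theorem isMinOn_tiClassWith_of_isMeanEnergyMinimiser {ω : InfVolFermionState d} (lam : κ → ℝ)
    (hmin : ω.IsMeanEnergyMinimiser (FermionInteraction.linearFamily Ψ C lam) R) :
    IsMinOn (fun σ : InfVolFermionState d => σ.meanEnergy Ψ R)
      (tiClassWith C R (fun k => ω.meanEnergy (C k) R)) ω := by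
  rw [isMinOn_iff]
  intro σ hσ
  have h := hmin.2 σ hσ.1
  rw [ω.meanEnergy_linearFamily, σ.meanEnergy_linearFamily] at h
  have hs : ∑ k, lam k * σ.meanEnergy (C k) R = ∑ k, lam k * ω.meanEnergy (C k) R :=
    Finset.sum_congr rfl fun k _ => by rw [hσ.2 k]
  linarith

/-- Hence its mean energy IS the constrained density at its charges:
`e_Ψ(ω) = e_{c(ω)}(Ψ)`. [cite: BratteliKishimotoRobinson1978, Thm. 2 (condition 2)] -/
theorem meanEnergy_eq_infMeanEnergyOn_tiClassWith_of_isMeanEnergyMinimiser {ω : InfVolFermionState d}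
    (lam : κ → ℝ) (hmin : ω.IsMeanEnergyMinimiser (FermionInteraction.linearFamily Ψ C lam) R) :
    ω.meanEnergy Ψ R =
      FermionInteraction.infMeanEnergyOn (tiClassWith C R (fun k => ω.meanEnergy (C k) R)) Ψ R :=
  FermionInteraction.meanEnergy_eq_infMeanEnergyOn_of_isMinOn Ψ R (mem_tiClassWith_self C R hmin.1)
    (isMinOn_tiClassWith_of_isMeanEnergyMinimiser C Ψ R lam hmin)

end InfVolFermionState

/-! ### §5. Instance: the `t–t'` Hubbard model with chemical potential and Zeeman field -/

section TTPrime

/-- The two conserved charges of the `t–t'` Hubbard model on `ℤ²`: particle number and spin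
imbalance. [cite: ArakiMoriya2003, §5.1] -/
def hubbardCharges : Fin 2 → FermionInteraction 2 := ![numberInteraction 2, spinImbalanceInteraction 2]

/-- **Mean energy of the field-coupled `t–t'` family**: for `θ = (θ₀, θ₁)`,
`e_{Φ(t,t',U) + θ₀ n + θ₁ s}(ω) = e^{tt'}(ω) + θ₀ ρ(ω) + θ₁ (ρ↑ − ρ↓)(ω)` (`θ = (−μ, −h)` for
`H − μN − h(N↑ − N↓)`). [cite: KomaTasaki1994, §1] -/
theorem meanEnergy_hubbardTTPrime_charges (ω : InfVolFermionState 2) (t t' U : ℝ) (θ : Fin 2 → ℝ) :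
    ω.meanEnergy (FermionInteraction.linearFamily (hubbardTTPrimeFermionInteraction t t' U) hubbardCharges θ) 1 =
      ω.meanEnergy (hubbardTTPrimeFermionInteraction t t' U) 1 + θ 0 * ω.density +
        θ 1 * ω.meanEnergy (spinImbalanceInteraction 2) 1 := by
  rw [ω.meanEnergy_linearFamily, Fin.sum_univ_two]
  simp only [hubbardCharges, Matrix.cons_val_zero, Matrix.cons_val_one,
    InfVolFermionState.meanEnergy_numberInteraction]
  ring

/-- **Joint concavity in `(μ, h)`** (stated in the coefficients `θ = (−μ, −h)`): the
translation-invariant ground-state energy density of `Φ(t,t',U) + θ₀ n + θ₁ s` is jointly concave in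
`θ ∈ ℝ²` (instance of `concaveOn_tiGroundEnergyDensity_linearFamily`). [cite: Israel1979, Thm. I.3.4] -/
theorem concaveOn_tiGroundEnergyDensity_hubbardTTPrime_charges (t t' U : ℝ) :
    ConcaveOn ℝ Set.univ fun θ : Fin 2 → ℝ =>
      (FermionInteraction.linearFamily (hubbardTTPrimeFermionInteraction t t' U) hubbardCharges θ).tiGroundEnergyDensity 1 :=
  FermionInteraction.concaveOn_tiGroundEnergyDensity_linearFamily _ _ 1

/-- **Legendre link `(μ, h) ↔ (ρ, m)` for the `t–t'` Hubbard model**: the translation-invariant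
density of `Φ(t,t',U) + θ₀ n + θ₁ s` is the greatest lower bound of
`{e_{(ρ, m₂)}(Φ) + θ₀ ρ + θ₁ m₂}` over the realised (density, spin-imbalance) pairs.
[cite: Ruelle1969, §3.4] -/
theorem isGLB_tiGroundEnergyDensity_hubbardTTPrime_charges (t t' U : ℝ) (θ : Fin 2 → ℝ) :
    IsGLB {y : ℝ | ∃ c : Fin 2 → ℝ, (InfVolFermionState.tiClassWith hubbardCharges 1 c).Nonempty ∧
        y = FermionInteraction.infMeanEnergyOn (InfVolFermionState.tiClassWith hubbardCharges 1 c)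
          (hubbardTTPrimeFermionInteraction t t' U) 1 + ∑ k, θ k * c k}
      ((FermionInteraction.linearFamily (hubbardTTPrimeFermionInteraction t t' U) hubbardCharges θ).tiGroundEnergyDensity 1) :=
  FermionInteraction.isGLB_tiGroundEnergyDensity_linearFamily_charges _ _ 1 θ

/-- **Joint convexity of the `t–t'` energy density in (filling, spin imbalance)** on every convex set
of realised pairs. [cite: Ruelle1969, §3.4] -/
theorem convexOn_infMeanEnergyOn_hubbardTTPrime_charges (t t' U : ℝ) {D : Set (Fin 2 → ℝ)}
    (hD : Convex ℝ D) (hne : ∀ c ∈ D, (InfVolFermionState.tiClassWith hubbardCharges 1 c).Nonempty) :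
    ConvexOn ℝ D fun c =>
      FermionInteraction.infMeanEnergyOn (InfVolFermionState.tiClassWith hubbardCharges 1 c)
        (hubbardTTPrimeFermionInteraction t t' U) 1 :=
  FermionInteraction.convexOn_infMeanEnergyOn_tiClassWith _ _ 1 hD hne

end TTPrime

/-! ### §6. Equivalence of ensembles, hard half: supporting slopes make canonical minimisers
grand-canonical minimisers -/

namespace InfVolFermionState

variable {κ : Type*} [Fintype κ] (C : κ → FermionInteraction d) (Ψ : FermionInteraction d) (R : ℝ)

/-- **Equivalence of ensembles, hard half.** Let `ω` minimise `e_Ψ` on the constraint class of charges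
`c` (a canonical ground state at `(ρ, m, …) = c`) and let `λ` be a SUPPORTING SLOPE of the constrained
density at `c`: `e_c(Ψ) + Σ_k λ_k c_k ≤ e_{c'}(Ψ) + Σ_k λ_k c'_k` for every realised `c'` (for the filling
this says `−λ = μ` lies in the subdifferential of the convex `ρ ↦ e_ρ` at `c`). Then `ω` minimises the
field-coupled family `Ψ + Σ_k λ_k C_k` over ALL translation-invariant states — it is a grand-canonical
ground state at `(μ, h, …) = −λ` (so every row certified for translation-invariant minimisers of
`H − μN − …` applies to it). Converse of `isMinOn_tiClassWith_of_isMeanEnergyMinimiser`.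
[cite: Ruelle1969, §3.4] -/
theorem isMeanEnergyMinimiser_linearFamily_of_supporting {ω : InfVolFermionState d} {c : κ → ℝ}
    (hω : ω ∈ tiClassWith C R c)
    (hmin : IsMinOn (fun σ : InfVolFermionState d => σ.meanEnergy Ψ R) (tiClassWith C R c) ω)
    (lam : κ → ℝ)
    (hsupp : ∀ c' : κ → ℝ, (tiClassWith C R c').Nonempty →
      FermionInteraction.infMeanEnergyOn (tiClassWith C R c) Ψ R + ∑ k, lam k * c k ≤
        FermionInteraction.infMeanEnergyOn (tiClassWith C R c') Ψ R + ∑ k, lam k * c' k) :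
    ω.IsMeanEnergyMinimiser (FermionInteraction.linearFamily Ψ C lam) R := by
  refine ⟨hω.1, fun σ hσ => ?_⟩
  rw [ω.meanEnergy_linearFamily, σ.meanEnergy_linearFamily]
  have hωe : ω.meanEnergy Ψ R = FermionInteraction.infMeanEnergyOn (tiClassWith C R c) Ψ R :=
    FermionInteraction.meanEnergy_eq_infMeanEnergyOn_of_isMinOn Ψ R hω hmin
  have hωc : ∑ k, lam k * ω.meanEnergy (C k) R = ∑ k, lam k * c k :=
    Finset.sum_congr rfl fun k _ => by rw [hω.2 k]
  have hσmem := mem_tiClassWith_self C R hσ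
  have h1 := hsupp _ ⟨σ, hσmem⟩
  have h2 := FermionInteraction.infMeanEnergyOn_le_meanEnergy Ψ R hσmem
  rw [hωe, hωc]
  linarith

/-- **Supporting slopes from a grand-canonical minimiser.** Conversely, the charges `c(ω)` of a
translation-invariant minimiser `ω` of `Ψ + Σ_k λ_k C_k` carry the supporting slope `λ`:
`e_{c(ω)}(Ψ) + Σ_k λ_k c_k(ω) ≤ e_{c'}(Ψ) + Σ_k λ_k c'_k` for every realised `c'`.
[cite: Ruelle1969, §3.4] -/
theorem supporting_of_isMeanEnergyMinimiser_linearFamily {ω : InfVolFermionState d} (lam : κ → ℝ)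
    (hmin : ω.IsMeanEnergyMinimiser (FermionInteraction.linearFamily Ψ C lam) R) {c' : κ → ℝ}
    (hne : (tiClassWith C R c').Nonempty) :
    FermionInteraction.infMeanEnergyOn (tiClassWith C R fun k => ω.meanEnergy (C k) R) Ψ R +
        ∑ k, lam k * ω.meanEnergy (C k) R ≤
      FermionInteraction.infMeanEnergyOn (tiClassWith C R c') Ψ R + ∑ k, lam k * c' k := by
  have h1 := FermionInteraction.tiGroundEnergyDensity_linearFamily_sub_sum_le C Ψ R lam hne
  have h2 : (FermionInteraction.linearFamily Ψ C lam).tiGroundEnergyDensity R =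
      ω.meanEnergy (FermionInteraction.linearFamily Ψ C lam) R := hmin.meanEnergy_eq.symm
  rw [h2, ω.meanEnergy_linearFamily,
    meanEnergy_eq_infMeanEnergyOn_tiClassWith_of_isMeanEnergyMinimiser C Ψ R lam hmin] at h1
  linarith

/-- **EQUIVALENCE OF ENSEMBLES for translation-invariant minimisers.** `ω` minimises the field-coupled
family `Ψ + Σ_k λ_k C_k` over the translation-invariant states iff it is translation invariant,
minimises `e_Ψ` on the constraint class of its own charges, and `λ` is a supporting slope of the
constrained density there. [cite: Ruelle1969, §3.4] -/
theorem isMeanEnergyMinimiser_linearFamily_iff {ω : InfVolFermionState d} (lam : κ → ℝ) :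
    ω.IsMeanEnergyMinimiser (FermionInteraction.linearFamily Ψ C lam) R ↔
      ω.IsTranslationInvariant ∧
        IsMinOn (fun σ : InfVolFermionState d => σ.meanEnergy Ψ R)
          (tiClassWith C R fun k => ω.meanEnergy (C k) R) ω ∧
        ∀ c' : κ → ℝ, (tiClassWith C R c').Nonempty →
          FermionInteraction.infMeanEnergyOn (tiClassWith C R fun k => ω.meanEnergy (C k) R) Ψ R +
              ∑ k, lam k * ω.meanEnergy (C k) R ≤
            FermionInteraction.infMeanEnergyOn (tiClassWith C R c') Ψ R + ∑ k, lam k * c' k :=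
  ⟨fun h => ⟨h.1, isMinOn_tiClassWith_of_isMeanEnergyMinimiser C Ψ R lam h,
      fun _ hne => supporting_of_isMeanEnergyMinimiser_linearFamily C Ψ R lam h hne⟩,
    fun h => isMeanEnergyMinimiser_linearFamily_of_supporting C Ψ R (mem_tiClassWith_self C R h.1) h.2.1
      lam h.2.2⟩

end InfVolFermionState

end Literature.MathematicalPhysics.QuantumLattice

end
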